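import Mathlib
import HarnessLib

/-!
# Route `F4SubCurvatureDoor`, crux ⟨stmt-QuantumFields-23125⟩ `RationalToGeneral` / parent ⟨23035⟩ `ShortRootRigidity`:
# LINE g16-A «GLOBAL REDUCTION», obligation C2 `GermToGlobal` — PROVED (port of the owner's kernel-closed proof)

The route owner's files-only skeleton `HOME ym-idea-3/l16/GlobalReduction.lean` (planner `ym-idea-3` g16, evidence #8 on 23125)
reduces `ShortRootRigidity` to three obligations,
`ShortRootRigidity_of : JointAnalyticityOffMirrors → GermToGlobal → GlobalShortRootRigidity → ShortRootRigidity`.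
This file lands obligation C2 as a tree theorem, with the Prop SPELLED OUT (no new definitions):

* `germToGlobal` — a kernel `K : ℝ⁴ → ℝ` continuous off `0` and jointly real-analytic on the open orthants
  `{∀ i, xᵢ ≠ 0}` which is invariant under a linear isometry `R` on a punctured ball `0 < ‖x‖ < ρ` is invariant under `R`
  on all of `ℝ⁴ ∖ 0`.  Proof (the owner's, verbatim up to a deprecated-tactic fix): for `x₀` with all coordinates of
  `x₀` and of `R x₀` non-zero, `D = K ∘ R − K` is analytic on the CONVEX cone
  `U = {x | ∀ i, x₀ᵢ xᵢ > 0 ∧ (R x₀)ᵢ (R x)ᵢ > 0}`, which contains `x₀` and the point `(ρ / 2‖x₀‖) • x₀` of the germ ball, so the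
  identity theorem (`AnalyticOnNhd.eqOn_zero_of_preconnected_of_eventuallyEq_zero`) gives `D x₀ = 0`; such `x₀` are dense (finite
  intersection of open dense complements of hyperplanes); continuity of `D` off `0` finishes.

Mathlib only; THEOREMS ONLY; no `sorry`; standard axioms.  HONEST FRAMING: a support lemma toward the OPEN crux 23125 / 23035
(`--supports stmt-QuantumFields-23125`); obligations C1 (`JointAnalyticityOffMirrors`, known tools) and C3 (`GlobalShortRootRigidity`,
THE WALL) are untouched; no crux, rung of LADDER-YM (`BalabanLadder.ROT`) or mass-gap statement is proved.  Width seat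
`ym-line-sfw-p2-w4` g19 (cell ym-idea-1, free hands), answering the owner's ASK (3) of 2026-08-28T23:44Z. [folklore]
-/

set_option autoImplicit false

namespace Summit.QuantumFields.YangMills.Theorems.F4SubCurvatureDoorGlobalReduction

open scoped Topology
open Filter Set

/-- **Germ-to-global for isometry invariance of kernels analytic off the coordinate mirrors** (obligation C2 `GermToGlobal` of
LINE g16-A, spelled out): if `K : ℝ⁴ → ℝ` is continuous off `0`, real-analytic on `{∀ i, xᵢ ≠ 0}`, and `K (R x) = K x` for all
`0 < ‖x‖ < ρ` for a linear isometry `R`, then `K (R x) = K x` for every `x ≠ 0`. [folklore] -/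
theorem germToGlobal : ∀ K : EuclideanSpace ℝ (Fin 4) → ℝ,
    ContinuousOn K {x | x ≠ 0} →
    AnalyticOnNhd ℝ K {x | ∀ i, x i ≠ 0} →
    ∀ (R : EuclideanSpace ℝ (Fin 4) ≃ₗᵢ[ℝ] EuclideanSpace ℝ (Fin 4)) (ρ : ℝ), 0 < ρ →
      (∀ x, x ≠ 0 → ‖x‖ < ρ → K (R x) = K x) → ∀ x, x ≠ 0 → K (R x) = K x := by
  intro K hK hA R ρ hρ hgerm
  let D : EuclideanSpace ℝ (Fin 4) → ℝ := fun x => K (R x) - K x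
  have hRan : ∀ x : EuclideanSpace ℝ (Fin 4), AnalyticAt ℝ (fun y => R y) x := fun x =>
    (R.toContinuousLinearEquiv : EuclideanSpace ℝ (Fin 4) →L[ℝ] EuclideanSpace ℝ (Fin 4)).analyticAt x
  have hDan : ∀ x : EuclideanSpace ℝ (Fin 4), (∀ i, x i ≠ 0) → (∀ i, (R x) i ≠ 0) →
      AnalyticAt ℝ D x := by
    intro x hx hRx
    exact ((hA (R x) hRx).comp (hRan x)).sub (hA x hx)
  -- Step 1: `D = 0` at every point with all coordinates of `x` and of `R x` non-zero (cone argument).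
  have hS : ∀ x₀ : EuclideanSpace ℝ (Fin 4), (∀ i, x₀ i ≠ 0) → (∀ i, (R x₀) i ≠ 0) → D x₀ = 0 := by
    intro x₀ hx₀ hRx₀
    let U : Set (EuclideanSpace ℝ (Fin 4)) := {x | ∀ i, 0 < x₀ i * x i ∧ 0 < (R x₀) i * (R x) i}
    have hx₀U : x₀ ∈ U := fun i => ⟨mul_self_pos.mpr (hx₀ i), mul_self_pos.mpr (hRx₀ i)⟩
    have hUne : ∀ x ∈ U, (∀ i, x i ≠ 0) ∧ (∀ i, (R x) i ≠ 0) := by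
      intro x hx
      refine ⟨fun i h => ?_, fun i h => ?_⟩
      · have h' := (hx i).1; rw [h, mul_zero] at h'; exact lt_irrefl _ h'
      · have h' := (hx i).2; rw [h, mul_zero] at h'; exact lt_irrefl _ h'
    have hUan : AnalyticOnNhd ℝ D U := fun x hx => hDan x (hUne x hx).1 (hUne x hx).2
    have key : ∀ (a b p q c : ℝ), 0 ≤ a → 0 ≤ b → a + b = 1 → 0 < c * p → 0 < c * q →
        0 < c * (a * p + b * q) := by
      intro a b p q c ha hb hab hp hq
      have hab' : 0 < a ∨ 0 < b := by
        by_contra hcon; push Not at hcon; linarith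
      have e : c * (a * p + b * q) = a * (c * p) + b * (c * q) := by ring
      rw [e]
      rcases hab' with ha' | hb'
      · exact add_pos_of_pos_of_nonneg (mul_pos ha' hp) (mul_nonneg hb hq.le)
      · exact add_pos_of_nonneg_of_pos (mul_nonneg ha hp.le) (mul_pos hb' hq)
    have hUconv : Convex ℝ U := by
      intro x hx y hy a b ha hb hab i
      refine ⟨?_, ?_⟩
      · have e : (a • x + b • y) i = a * x i + b * y i := by simp
        rw [e]; exact key a b _ _ _ ha hb hab (hx i).1 (hy i).1
      · have e : (R (a • x + b • y)) i = a * (R x) i + b * (R y) i := by simp [map_add, map_smul]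
        rw [e]; exact key a b _ _ _ ha hb hab (hx i).2 (hy i).2
    have hx₀ne : x₀ ≠ 0 := by intro h; apply hx₀ 0; simp [h]
    have hnorm : 0 < ‖x₀‖ := norm_pos_iff.mpr hx₀ne
    set t : ℝ := ρ / (2 * ‖x₀‖) with ht_def
    have ht : 0 < t := by positivity
    set z₀ : EuclideanSpace ℝ (Fin 4) := t • x₀ with hz₀_def
    have hz₀U : z₀ ∈ U := by
      intro i
      refine ⟨?_, ?_⟩
      · have e : z₀ i = t * x₀ i := by simp [hz₀_def]
        rw [e]; have h' := mul_self_pos.mpr (hx₀ i); nlinarith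
      · have e : (R z₀) i = t * (R x₀) i := by simp [hz₀_def, map_smul]
        rw [e]; have h' := mul_self_pos.mpr (hRx₀ i); nlinarith
    have hz₀norm : ‖z₀‖ < ρ := by
      have e : ‖z₀‖ = t * ‖x₀‖ := by simp [hz₀_def, norm_smul, abs_of_pos ht]
      have e' : t * ‖x₀‖ = ρ / 2 := by rw [ht_def]; field_simp
      rw [e, e']; linarith
    have hz₀ne : z₀ ≠ 0 := smul_ne_zero ht.ne' hx₀ne
    have hDz : D =ᶠ[𝓝 z₀] 0 := by
      have hW : IsOpen ({y : EuclideanSpace ℝ (Fin 4) | y ≠ 0} ∩ {y | ‖y‖ < ρ}) :=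
        isOpen_ne.inter (isOpen_lt continuous_norm continuous_const)
      filter_upwards [hW.mem_nhds ⟨hz₀ne, hz₀norm⟩] with y hy
      simp [D, hgerm y hy.1 hy.2]
    exact hUan.eqOn_zero_of_preconnected_of_eventuallyEq_zero hUconv.isPreconnected hz₀U hDz hx₀U
  -- Step 2: the set of such points is dense (finite intersection of complements of hyperplanes).
  have hdense_aux : ∀ f : EuclideanSpace ℝ (Fin 4) → ℝ, (∀ x y, f (x + y) = f x + f y) →
      (∀ (s : ℝ) (x : EuclideanSpace ℝ (Fin 4)), f (s • x) = s * f x) →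
      ∀ w, f w ≠ 0 → Dense {x | f x ≠ 0} := by
    intro f hadd hsmul w hw
    rw [Metric.dense_iff]
    intro x r hr
    by_cases hfx : f x = 0
    · have hw0 : w ≠ 0 := by
        rintro rfl
        apply hw
        have h0 := hsmul 0 0
        simp only [zero_smul, zero_mul] at h0
        exact h0
      have hwn : 0 < ‖w‖ := norm_pos_iff.mpr hw0
      set s : ℝ := r / (2 * ‖w‖) with hs_def
      have hs : 0 < s := by positivity
      refine ⟨x + s • w, ?_, ?_⟩
      · rw [Metric.mem_ball, dist_eq_norm]
        have e : x + s • w - x = s • w := by abel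
        rw [e, norm_smul, Real.norm_eq_abs, abs_of_pos hs]
        have e' : s * ‖w‖ = r / 2 := by rw [hs_def]; field_simp
        rw [e']; linarith
      · show f (x + s • w) ≠ 0
        rw [hadd, hsmul, hfx, zero_add]
        exact mul_ne_zero hs.ne' hw
    · exact ⟨x, Metric.mem_ball_self hr, hfx⟩
  have hAi : ∀ i : Fin 4, Dense {x : EuclideanSpace ℝ (Fin 4) | x i ≠ 0} := by
    intro i
    refine hdense_aux (fun x => x i) (fun x y => by simp) (fun s x => by simp)
      (EuclideanSpace.single i (1 : ℝ)) ?_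
    simp
  have hBi : ∀ i : Fin 4, Dense {x : EuclideanSpace ℝ (Fin 4) | (R x) i ≠ 0} := by
    intro i
    refine hdense_aux (fun x => (R x) i) (fun x y => by simp [map_add]) (fun s x => by simp [map_smul])
      (R.symm (EuclideanSpace.single i (1 : ℝ))) ?_
    simp
  have hAo : ∀ i : Fin 4, IsOpen {x : EuclideanSpace ℝ (Fin 4) | x i ≠ 0} := fun i =>
    isOpen_ne_fun (PiLp.continuous_apply 2 (fun _ : Fin 4 => ℝ) i) continuous_const
  have hBo : ∀ i : Fin 4, IsOpen {x : EuclideanSpace ℝ (Fin 4) | (R x) i ≠ 0} := fun i =>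
    isOpen_ne_fun ((PiLp.continuous_apply 2 (fun _ : Fin 4 => ℝ) i).comp R.continuous) continuous_const
  let S : Set (EuclideanSpace ℝ (Fin 4)) := ⋂ i : Fin 4, ({x | x i ≠ 0} ∩ {x | (R x) i ≠ 0})
  have hSdense : Dense S :=
    dense_iInter_of_isOpen (fun i => (hAo i).inter (hBo i))
      (fun i => (hAi i).inter_of_isOpen_right (hBi i) (hBo i))
  have hDS : ∀ x ∈ S, D x = 0 := by
    intro x hx
    have hx' : ∀ i, x i ≠ 0 ∧ (R x) i ≠ 0 := fun i => by
      have := Set.mem_iInter.mp hx i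
      exact this
    exact hS x (fun i => (hx' i).1) (fun i => (hx' i).2)
  -- Step 3: continuity off the origin.
  intro y hy
  have hRy : R y ≠ 0 := by
    intro h; apply hy
    have e : ‖R y‖ = ‖y‖ := R.norm_map y
    rw [h, norm_zero] at e
    exact norm_eq_zero.mp e.symm
  have hKy : ContinuousAt K y := hK.continuousAt (isOpen_ne.mem_nhds hy)
  have hKRy : ContinuousAt (fun x => K (R x)) y :=
    (hK.continuousAt (isOpen_ne.mem_nhds hRy)).comp R.continuous.continuousAt
  have hDy : ContinuousAt D y := hKRy.sub hKy
  have h1 : Tendsto D (𝓝[S] y) (𝓝 (D y)) := hDy.tendsto.mono_left nhdsWithin_le_nhds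
  have h2 : Tendsto D (𝓝[S] y) (𝓝 0) := by
    refine tendsto_const_nhds.congr' ?_
    filter_upwards [self_mem_nhdsWithin] with x hx
    exact (hDS x hx).symm
  haveI : (𝓝[S] y).NeBot := mem_closure_iff_nhdsWithin_neBot.mp (hSdense y)
  have hDy0 : D y = 0 := tendsto_nhds_unique h1 h2
  exact sub_eq_zero.mp hDy0

end Summit.QuantumFields.YangMills.Theorems.F4SubCurvatureDoorGlobalReduction
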